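import Summits.SmoothPoincare4.SmoothPoincare4.Theorems.EntropyRungBakryEmeryLogSobolevCauchy
import Summits.SmoothPoincare4.SmoothPoincare4.Theorems.EntropyRungNoncompactShrinkerGapHeatFlatCorrector
import Literature.Geometry.Riemannian.WeightedHeatFlowFromLinearHeat
import HarnessLib

/-!
# Existence of the weighted heat flow `∂ₛρ = Δ_g ρ − g⁻¹(dV, dρ)` from data constant outside a compact set on
# a complete weighted manifold with ARBITRARY smooth weight
# (support item `EntropyRung.BakryEmeryLogSobolev`, stmt-SmoothPoincare4-16587)

`weightedHeatFlow_exists_gaffney`: on `M` modelled on `ℝⁿ` (Hausdorff, second countable, `T₃`, Borel — NOT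
compact) with `g` Riemannian (Levi-Civita connection), `V` smooth (NO further assumption) and Gaffney
cut-offs, for `c₀ ∈ ℝ`, `ψ₀ ∈ C_c^∞` and `T > 0` there are an open `O ⊇ [0, T]` and `ρ` smooth on `M × O`
with `ρ(0) = c₀ + ψ₀`, `∂ₛρ = Δ_g ρ − g⁻¹(dV, dρ)` on `[0, T]` and `(ρ − c₀)² e^{-V} ∈ L¹(M × (0, T))` — the
`𝕃²(e^{-V}dV_g)` heat flow, i.e. the minimal heat semigroup `P_T(c₀ + ψ₀)` of the weighted manifold
(Bakry–Gentil–Ledoux 2014, §3.2.3; Grigor'yan 2009, Ch. 7–8). This is the shrinker toolkit's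
`helper_heatFlowExistence_of` (`EntropyRungNoncompactShrinkerGapHeatFlowExistence.lean`, crux
`EntropyRung.NoncompactShrinkerGap`: ground-state transform `ρ = c₀ + e^{V/2}e^{s}w`, `heatDrift_of_potential`,
the flat corrector `helper_flatCorrector_noncompact`) with the linear Cauchy solver `linearHeat_cauchy_gaffney`,
which needs no lower bound on `¼|∇V|² − ½ΔV`. Everything is proved; no definitions, no named facts.

## References

* [BakryGentilLedoux2014] D. Bakry, I. Gentil, M. Ledoux (2014), §3.2.3 (p. 142) and §1.15.7.
* [Grigoryan2009] A. Grigor'yan, *Heat Kernel and Analysis on Manifolds* (2009), Ch. 7–8.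
* [Treves1975] F. Trèves (1975), §41, Thm. 40.1.
-/

noncomputable section

set_option linter.dupNamespace false

open scoped Manifold ContDiff ENNReal NNReal Topology
open MeasureTheory Set Filter
open Literature.Geometry.Lorentzian Literature.Geometry.Riemannian

namespace Summit.SmoothPoincare4.SmoothPoincare4.Theorems.BakryEmeryComplete

open NoncompactShrinkerGapHeat

section Flow

variable {n : ℕ} {M : Type*} [TopologicalSpace M] [T2Space M] [SecondCountableTopology M]
  [ChartedSpace (EuclideanSpace ℝ (Fin n)) M] [IsManifold (𝓡 n) ∞ M] [T3Space M] [MeasurableSpace M]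
  [BorelSpace M]
  {g : PseudoRiemannianMetric (𝓡 n) ∞ (EuclideanSpace ℝ (Fin n)) (TangentSpace (𝓡 n) : M → Type _)}
  [g.HasLeviCivita]

/-- **Existence of the weighted heat flow from `c₀ + ψ₀`, `ψ₀ ∈ C_c^∞`, on a complete weighted manifold with
arbitrary smooth weight** (see the module docstring). [cite: BakryGentilLedoux2014, §3.2.3 (p. 142)]
[cite: Grigoryan2009, Ch. 7] [cite: Treves1975, §41, Thm. 40.1] -/
theorem weightedHeatFlow_exists_gaffney (hg : g.IsRiemannian) {V : M → ℝ} (hV : ContMDiff (𝓡 n) 𝓘(ℝ, ℝ) ∞ V)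
    {η : ℕ → M → ℝ} {C₀ : ℝ} (hηs : ∀ k, ContMDiff (𝓡 n) 𝓘(ℝ, ℝ) ∞ (η k))
    (hηc : ∀ k, HasCompactSupport (η k)) (hη01 : ∀ k x, 0 ≤ η k x ∧ η k x ≤ 1)
    (hηmono : ∀ k x, η k x ≤ η (k + 1) x) (hη1 : ∀ x, ∀ᶠ k in atTop, η k x = 1)
    (hηgrad : ∀ k x, g.gradSq (η k) x ≤ C₀ / ((k : ℝ) + 1) ^ 2)
    (c₀ : ℝ) {ψ₀ : M → ℝ} (hψ : ContMDiff (𝓡 n) 𝓘(ℝ, ℝ) ∞ ψ₀) (hψc : HasCompactSupport ψ₀) {T : ℝ}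
    (hT : 0 < T) :
    ∃ (O : Set ℝ) (ρ : ℝ → M → ℝ), IsOpen O ∧ Icc 0 T ⊆ O ∧
      ContMDiffOn ((𝓡 n).prod 𝓘(ℝ, ℝ)) 𝓘(ℝ, ℝ) ∞ (fun p : M × ℝ ↦ ρ p.2 p.1) (univ ×ˢ O) ∧
      (∀ x, ρ 0 x = c₀ + ψ₀ x) ∧
      (∀ s ∈ Icc 0 T, ∀ x, deriv (fun r ↦ ρ r x) s = g.dalembertian (ρ s) x
        - g.innerDual x (mvfderiv (𝓡 n) V x).toLinearMap (mvfderiv (𝓡 n) (ρ s) x).toLinearMap) ∧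
      Integrable (fun p : M × ℝ ↦ (ρ p.2 p.1 - c₀) ^ 2 * Real.exp (-V p.1))
        ((g.riemVolume.prod (volume : Measure ℝ)).restrict (univ ×ˢ Ioo 0 T)) := by
  classical
  -- the potential `Q = ¼|∇V|² − ½ΔV + 1` (time independent; NO lower bound)
  set Q : ℝ → M → ℝ := fun _ x ↦ g.gradSq V x / 4 - g.dalembertian V x / 2 + 1 with hQdef
  have hQs : ContMDiff ((𝓡 n).prod 𝓘(ℝ, ℝ)) 𝓘(ℝ, ℝ) ∞ (fun p : M × ℝ ↦ Q p.2 p.1) := by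
    have h1 : ContMDiff (𝓡 n) 𝓘(ℝ, ℝ) ∞ (fun x ↦ g.gradSq V x / 4 - g.dalembertian V x / 2 + 1) :=
      (((contMDiff_gradSq g hV).div_const 4).sub ((contMDiff_dalembertian g hV).div_const 2)).add
        contMDiff_const
    exact h1.comp contMDiff_fst
  -- the datum `w₀ = e^{-V/2} ψ₀`
  set w₀ : M → ℝ := fun x ↦ Real.exp (-(V x / 2)) * ψ₀ x with hw₀def
  have hw₀ : ContMDiff (𝓡 n) 𝓘(ℝ, ℝ) ∞ w₀ :=
    ((contMDiff_iff_contDiff.2 Real.contDiff_exp).comp (hV.div_const 2).neg).mul hψ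
  have hw₀c : HasCompactSupport w₀ := hψc.mul_left
  -- the flat corrector and the linear Cauchy problem
  obtain ⟨W, G, K, hK, hW, hG, hW0, hWK, hGK, hWG1, hG0, hGW⟩ :=
    helper_flatCorrector_noncompact n M g Q hQs w₀ hw₀ hw₀c
  obtain ⟨O, w, hO, hTO, hws, hw0, hweq, hwL2⟩ :=
    linearHeat_cauchy_gaffney hg hV hηs hηc hη01 hηmono hη1 hηgrad hK hW hG hWK hGK hWG1 hG0 hGW hT
  -- the candidate `ρ = c₀ + e^{V/2} e^{s} w`
  set lam : ℝ := 1 with hlamdef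
  set u : ℝ → M → ℝ := fun s x ↦ Real.exp (V x / 2) * (Real.exp (lam * s) * w s x) with hudef
  set ρ : ℝ → M → ℝ := fun s x ↦ 1 * u s x + c₀ with hρdef
  have hus : ContMDiffOn ((𝓡 n).prod 𝓘(ℝ, ℝ)) 𝓘(ℝ, ℝ) ∞ (fun p : M × ℝ ↦ u p.2 p.1) (univ ×ˢ O) := by
    have hE : ContMDiff ((𝓡 n).prod 𝓘(ℝ, ℝ)) 𝓘(ℝ, ℝ) ∞ (fun p : M × ℝ ↦ Real.exp (V p.1 / 2)) :=
      ((contMDiff_iff_contDiff.2 Real.contDiff_exp).comp ((hV.comp contMDiff_fst).div_const 2))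
    have hL : ContMDiff ((𝓡 n).prod 𝓘(ℝ, ℝ)) 𝓘(ℝ, ℝ) ∞ (fun p : M × ℝ ↦ Real.exp (lam * p.2)) :=
      (contMDiff_iff_contDiff.2 Real.contDiff_exp).comp (contMDiff_const.mul contMDiff_snd)
    exact hE.contMDiffOn.mul (hL.contMDiffOn.mul hws)
  have hρs : ContMDiffOn ((𝓡 n).prod 𝓘(ℝ, ℝ)) 𝓘(ℝ, ℝ) ∞ (fun p : M × ℝ ↦ ρ p.2 p.1) (univ ×ˢ O) :=
    (contMDiffOn_const.mul hus).add contMDiffOn_const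
  refine ⟨O, ρ, hO, hTO, hρs, fun x ↦ ?_, fun s hs x ↦ ?_, ?_⟩
  · -- `ρ(0) = c₀ + ψ₀`
    have h1 : Real.exp (V x / 2) * Real.exp (-(V x / 2)) = 1 := by
      rw [← Real.exp_add]; simp
    simp only [hρdef, hudef, hw0, hW0, hw₀def, mul_zero, Real.exp_zero, one_mul]
    calc Real.exp (V x / 2) * (Real.exp (-(V x / 2)) * ψ₀ x) + c₀
        = (Real.exp (V x / 2) * Real.exp (-(V x / 2))) * ψ₀ x + c₀ := by ring
      _ = c₀ + ψ₀ x := by rw [h1]; ring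
  · -- the equation: exponential shift, then conjugation by `e^{V/2}`
    have hsO : s ∈ O := hTO hs
    have h2 : (2 : ℕ∞ω) ≤ (∞ : ℕ∞ω) := by norm_cast
    have hslice : ContMDiff (𝓡 n) 𝓘(ℝ, ℝ) ∞ (w s) :=
      hws.comp_contMDiff (contMDiff_id.prodMk contMDiff_const) fun y ↦ ⟨mem_univ _, hsO⟩
    have hws2 : ContMDiffAt (𝓡 n) 𝓘(ℝ, ℝ) 2 (w s) x := (hslice.of_le h2).contMDiffAt
    -- the shifted function `w̃ = e^{λ s} w`
    set wt : ℝ → M → ℝ := fun r y ↦ Real.exp (lam * r) * w r y with hwtdef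
    have hwt2 : ContMDiffAt (𝓡 n) 𝓘(ℝ, ℝ) 2 (wt s) x := (contMDiffAt_const.mul hws2 :)
    have hdw : HasDerivAt (fun r ↦ w r x) (g.dalembertian (w s) x - Q s x * w s x) s := by
      have h := CutoffToolkit.hasDerivAt_time hO hws x hsO
      rw [hweq s hs x] at h
      exact h
    have hdE : HasDerivAt (fun r : ℝ ↦ Real.exp (lam * r)) (lam * Real.exp (lam * s)) s := by
      have := ((hasDerivAt_id s).const_mul lam).exp
      simpa [mul_comm] using this
    have hdwt : HasDerivAt (fun r ↦ wt r x)
        (g.dalembertian (wt s) x - (g.gradSq V x / 4 - g.dalembertian V x / 2) * wt s x) s := by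
      have h := hdE.mul hdw
      have hΔ : g.dalembertian (wt s) x = Real.exp (lam * s) * g.dalembertian (w s) x := by
        show g.dalembertian (fun y ↦ Real.exp (lam * s) * w s y) x = _
        exact g.dalembertian_const_mul_of_contMDiffAt hws2 _
      rw [hΔ]
      refine h.congr_deriv ?_
      simp only [hwtdef, hQdef, hlamdef]
      ring
    have hconj := heatDrift_of_potential g hV (S := univ) hwt2 hdwt.hasDerivWithinAt
    have hdu : HasDerivAt (fun r ↦ u r x)
        (g.dalembertian (u s) x - g.innerDual x (mvfderiv (𝓡 n) V x).toLinearMap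
          (mvfderiv (𝓡 n) (u s) x).toLinearMap) s := by
      have h := hconj.hasDerivAt (Filter.univ_mem)
      simpa [hudef, hwtdef] using h
    have hdρ : HasDerivAt (fun r ↦ ρ r x)
        (1 * (g.dalembertian (u s) x - g.innerDual x (mvfderiv (𝓡 n) V x).toLinearMap
          (mvfderiv (𝓡 n) (u s) x).toLinearMap)) s := by
      have := (hdu.const_mul 1).add_const c₀
      simpa [hρdef] using this
    rw [hdρ.deriv]
    have hu2 : ContMDiffAt (𝓡 n) 𝓘(ℝ, ℝ) 2 (u s) x := by
      have hA : ContMDiffAt (𝓡 n) 𝓘(ℝ, ℝ) 2 (fun y ↦ Real.exp (V y / 2)) x :=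
        (((contMDiff_iff_contDiff.2 Real.contDiff_exp).comp (hV.div_const 2)).of_le h2).contMDiffAt
      exact hA.mul hwt2
    have haff := weightedLaplacian_affine (g := g) (V := V) hu2 1 c₀
    rw [show ρ s = fun y ↦ 1 * u s y + c₀ from rfl, haff]
  · -- `(ρ − c₀)² e^{-V} = e^{2λs} w² ≤ e^{2|λ|T} w²` on the strip
    have hmeasS : MeasurableSet ((univ : Set M) ×ˢ Ioo (0 : ℝ) T) := MeasurableSet.univ.prod measurableSet_Ioo
    refine (hwL2.const_mul (Real.exp (2 * |lam| * T))).mono' ?_ ?_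
    · have hsub : (univ : Set M) ×ˢ Ioo (0 : ℝ) T ⊆ univ ×ˢ O :=
        Set.prod_mono le_rfl fun s hs ↦ hTO (Ioo_subset_Icc_self hs)
      have hρc : ContinuousOn (fun p : M × ℝ ↦ ρ p.2 p.1) ((univ : Set M) ×ˢ Ioo (0 : ℝ) T) :=
        hρs.continuousOn.mono hsub
      have hc : ContinuousOn (fun p : M × ℝ ↦ (ρ p.2 p.1 - c₀) ^ 2 * Real.exp (-V p.1))
          ((univ : Set M) ×ˢ Ioo (0 : ℝ) T) :=
        ((hρc.sub continuousOn_const).pow 2).mul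
          (Real.continuous_exp.comp (hV.continuous.comp continuous_fst).neg).continuousOn
      exact hc.aestronglyMeasurable hmeasS
    · rw [ae_restrict_iff' hmeasS]
      refine Eventually.of_forall fun p hp ↦ ?_
      obtain ⟨-, hs⟩ := hp
      have h1 : (ρ p.2 p.1 - c₀) ^ 2 * Real.exp (-V p.1) = Real.exp (2 * (lam * p.2)) * w p.2 p.1 ^ 2 := by
        simp only [hρdef, hudef]
        have hE : Real.exp (V p.1 / 2) ^ 2 * Real.exp (-V p.1) = 1 := by
          rw [sq, ← Real.exp_add, ← Real.exp_add]
          convert Real.exp_zero using 2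
          ring
        have hL : Real.exp (lam * p.2) ^ 2 = Real.exp (2 * (lam * p.2)) := by
          rw [sq, ← Real.exp_add]
          congr 1
          ring
        calc (1 * (Real.exp (V p.1 / 2) * (Real.exp (lam * p.2) * w p.2 p.1)) + c₀ - c₀) ^ 2 * Real.exp (-V p.1)
            = (Real.exp (V p.1 / 2) ^ 2 * Real.exp (-V p.1)) * (Real.exp (lam * p.2) ^ 2 * w p.2 p.1 ^ 2) := by
              ring
          _ = Real.exp (2 * (lam * p.2)) * w p.2 p.1 ^ 2 := by rw [hE, hL, one_mul]
      rw [Real.norm_eq_abs, h1, abs_of_nonneg (by positivity)]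
      refine mul_le_mul_of_nonneg_right (Real.exp_le_exp.2 ?_) (sq_nonneg _)
      have h3 : lam * p.2 ≤ |lam| * T := by
        calc lam * p.2 ≤ |lam| * p.2 := mul_le_mul_of_nonneg_right (le_abs_self _) hs.1.le
          _ ≤ |lam| * T := mul_le_mul_of_nonneg_left hs.2.le (abs_nonneg _)
      linarith

end Flow

end Summit.SmoothPoincare4.SmoothPoincare4.Theorems.BakryEmeryComplete

end
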